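import Summits.KontsevichZagierPeriods.KontsevichZagierPeriods.Theorems.LinRedNormalFormArrangementNormalFormStubIntegrateOutLowHelpers

/-!
# Order cells of Janus representations (`stub_integrateOutLow`, line `janus-bands`)

The combinatorial half of `stub_integrateOutLow` (crux `ArrangementNormalForm`): a bounded
representation whose domain is cut out by finitely many strict order constraints between
"players" — fibre coordinates and rational affine functions of the base — and whose integrand
has the Janus form `p(x)/∏ Lⱼ(x)^{eⱼ} · ∏ᵢ (tᵢ − cᵢ(x))⁻¹` is a `ℤ`-combination of JANUS BAND
representations (every fibre with exactly one lower and one upper bound) modulo the KZ moves: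
**total-order refinement** (`IntegrateOutLow.of_sub_sum_cell_mem_relations`) by the chains of
players; on the piece of a chain consistent with the constraints every fibre gets its two
neighbours as bounds and the comparisons of adjacent affine players become rows of the base cell
(`IntegrateOutLow.exists_inter_chain_eq`); inconsistent chains have empty pieces.

Main result: `integrateOutLow_orderCells` (registered sub-goal of `stub_integrateOutLow`).
-/

noncomputable section

open MeasureTheory Set MvPolynomial
open Literature.NumberTheory.Transcendental Literature.ModelTheory.ExponentialFields

namespace Summit.KontsevichZagierPeriods.ArrangementNormalForm.JanusBands

namespace IntegrateOutLow

/-! ### Chains of players consistent with a finite set of order constraints -/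

section Chains

variable {X D : Type} {K : ℕ} (pv : Fin K ⊕ D → X → ℝ) (A : Finset D)
  (C : Finset ((Fin K ⊕ D) × (Fin K ⊕ D)))
  (hA : ∀ c ∈ C, ∀ d, (c.1 = Sum.inr d ∨ c.2 = Sum.inr d) → d ∈ A)
  (σ : Fin (Fintype.card (Fin K ⊕ A)) ≃ Fin K ⊕ A)

/-- A fibre-or-affine datum supported in `A` lifts to a player. -/
theorem exists_lift {u : Fin K ⊕ D} (hu : ∀ d, u = Sum.inr d → d ∈ A) :
    ∃ x : Fin K ⊕ A, Sum.map id Subtype.val x = u := by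
  rcases u with v | d
  · exact ⟨Sum.inl v, rfl⟩
  · exact ⟨Sum.inr ⟨d, hu d rfl⟩, rfl⟩

/-- Only a fibre lifts a fibre. -/
theorem eq_inl_of_map_eq {x : Fin K ⊕ A} {v : Fin K} (h : Sum.map id Subtype.val x = Sum.inl v) :
    x = Sum.inl v := by
  rcases x with w | d
  · simpa using h
  · simp at h

include hA in
/-- A chain inconsistent with the constraints has an empty piece. -/
theorem inter_chain_eq_empty (hnc : ¬ ∀ c ∈ C, ∃ x₁ x₂ : Fin K ⊕ A,
      Sum.map id Subtype.val x₁ = c.1 ∧ Sum.map id Subtype.val x₂ = c.2 ∧ σ.symm x₁ < σ.symm x₂) :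
    {x | ∀ c ∈ C, pv c.1 x < pv c.2 x} ∩
      {x | StrictMono fun i => pv (Sum.map id Subtype.val (σ i)) x} = ∅ := by
  push Not at hnc
  obtain ⟨c, hc, hle⟩ := hnc
  refine eq_empty_of_forall_notMem fun z ⟨hz, hcell⟩ => ?_
  obtain ⟨x₁, hx₁⟩ := exists_lift A (fun d hd => hA c hc d (Or.inl hd))
  obtain ⟨x₂, hx₂⟩ := exists_lift A (fun d hd => hA c hc d (Or.inr hd))
  have hmono := hcell.monotone (hle x₁ x₂ hx₁ hx₂)
  simp only [Equiv.apply_symm_apply, hx₁, hx₂] at hmono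
  exact absurd (hz c hc) (not_lt.2 hmono)

/-- **The piece of a consistent chain is a Janus cell**: on it every fibre has a unique lower
and a unique upper neighbour, and the remaining constraints compare adjacent affine players. -/
theorem exists_inter_chain_eq (hc : ∀ c ∈ C, ∃ x₁ x₂ : Fin K ⊕ A,
      Sum.map id Subtype.val x₁ = c.1 ∧ Sum.map id Subtype.val x₂ = c.2 ∧ σ.symm x₁ < σ.symm x₂)
    (hlu : ∀ v, (∃ c ∈ C, c.2 = Sum.inl v) ∧ (∃ c ∈ C, c.1 = Sum.inl v)) :
    ∃ lo hi : Fin K → Fin K ⊕ D, {x | ∀ c ∈ C, pv c.1 x < pv c.2 x} ∩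
      {x | StrictMono fun i => pv (Sum.map id Subtype.val (σ i)) x} =
      {x | (∀ (i : Fin (Fintype.card (Fin K ⊕ A))) (h : i.val + 1 < Fintype.card (Fin K ⊕ A))
        (d d' : D), Sum.map id Subtype.val (σ i) = Sum.inr d →
        Sum.map id Subtype.val (σ ⟨i.val + 1, h⟩) = Sum.inr d' →
        pv (Sum.inr d) x < pv (Sum.inr d') x) ∧
        ∀ v, pv (lo v) x < pv (Sum.inl v) x ∧ pv (Sum.inl v) x < pv (hi v) x} := by
  have hpos : ∀ v, 0 < (σ.symm (Sum.inl v)).val ∧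
      (σ.symm (Sum.inl v)).val + 1 < Fintype.card (Fin K ⊕ A) := by
    intro v
    obtain ⟨⟨c, hcC, hc2⟩, ⟨c', hc'C, hc'1⟩⟩ := hlu v
    obtain ⟨x₁, x₂, -, h2, hlt⟩ := hc c hcC
    obtain ⟨y₁, y₂, h1', -, hlt'⟩ := hc c' hc'C
    rw [hc2] at h2
    rw [hc'1] at h1'
    rw [eq_inl_of_map_eq A h2] at hlt
    rw [eq_inl_of_map_eq A h1'] at hlt'
    exact ⟨lt_of_le_of_lt (Nat.zero_le _) hlt,
      lt_of_le_of_lt (Nat.succ_le_of_lt hlt') (σ.symm y₂).2⟩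
  refine ⟨fun v => Sum.map id Subtype.val (σ ⟨(σ.symm (Sum.inl v)).val - 1,
      lt_of_le_of_lt (Nat.sub_le _ _) (σ.symm (Sum.inl v)).2⟩),
    fun v => if h : (σ.symm (Sum.inl v)).val + 1 < Fintype.card (Fin K ⊕ A) then
      Sum.map id Subtype.val (σ ⟨(σ.symm (Sum.inl v)).val + 1, h⟩) else Sum.inl v, ?_⟩
  ext z
  simp only [mem_inter_iff, mem_setOf_eq]
  constructor
  · rintro ⟨hz, hcell⟩
    have hf : ∀ i j, i < j → pv (Sum.map id Subtype.val (σ i)) z <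
        pv (Sum.map id Subtype.val (σ j)) z := fun i j hij => hcell hij
    refine ⟨fun i hi d d' hd hd' => ?_, fun v => ⟨?_, ?_⟩⟩
    · have h := hf i ⟨i.val + 1, hi⟩ (by rw [Fin.lt_def]; exact Nat.lt_succ_self _)
      rwa [hd, hd'] at h
    · have hpv := hf ⟨(σ.symm (Sum.inl v)).val - 1, lt_of_le_of_lt (Nat.sub_le _ _)
        (σ.symm (Sum.inl v)).2⟩ (σ.symm (Sum.inl v))
        (by rw [Fin.lt_def]; have := (hpos v).1; dsimp only; omega)
      rwa [Equiv.apply_symm_apply] at hpv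
    · rw [dif_pos (hpos v).2]
      have hpv := hf (σ.symm (Sum.inl v)) ⟨(σ.symm (Sum.inl v)).val + 1, (hpos v).2⟩
        (by rw [Fin.lt_def]; exact Nat.lt_succ_self _)
      rwa [Equiv.apply_symm_apply] at hpv
  · rintro ⟨hrow, hfib⟩
    have hadj : ∀ i : Fin (Fintype.card (Fin K ⊕ A)), ∀ hi : i.val + 1 < Fintype.card (Fin K ⊕ A),
        pv (Sum.map id Subtype.val (σ i)) z <
          pv (Sum.map id Subtype.val (σ ⟨i.val + 1, hi⟩)) z := by
      intro i hi
      rcases hσi : σ i with v | ⟨d, hd⟩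
      · have hp : σ.symm (Sum.inl v) = i := by rw [← hσi, Equiv.symm_apply_apply]
        have h2 := (hfib v).2
        simp only [hp, dif_pos hi] at h2
        exact h2
      · rcases hσi' : σ ⟨i.val + 1, hi⟩ with v' | ⟨d', hd'⟩
        · have hp : σ.symm (Sum.inl v') = ⟨i.val + 1, hi⟩ := by
            rw [← hσi', Equiv.symm_apply_apply]
          have h1 := (hfib v').1
          simp only [hp, Nat.add_sub_cancel, Fin.eta, hσi] at h1
          exact h1
        · exact hrow i hi d d' (by rw [hσi]; rfl) (by rw [hσi']; rfl)
    have hsm : StrictMono fun i => pv (Sum.map id Subtype.val (σ i)) z := strictMono_of_succ_lt hadj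
    refine ⟨fun c hcC => ?_, hsm⟩
    obtain ⟨x₁, x₂, hx₁, hx₂, hlt⟩ := hc c hcC
    have h := hsm hlt
    simp only [Equiv.apply_symm_apply, hx₁, hx₂] at h
    exact h

end Chains

/-! ### Janus players: fibre coordinates and affine functions of the base -/

variable {b K : ℕ}

/-- The player polynomials evaluate to the fibre coordinates / affine functions of the base. -/
theorem aeval_player (u : Fin K ⊕ ((Fin b → ℚ) × ℚ)) (z : Fin (b + K) → ℝ) :
    aeval z (Sum.elim (fun v => (X (Fin.natAdd b v) : MvPolynomial (Fin (b + K)) ℚ))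
      (fun d => rename (Fin.castAdd K) (∑ i, C (d.1 i) * X i + C d.2)) u) =
    Sum.elim (fun j => z (Fin.natAdd b j))
      (fun c => ∑ i', (c.1 i' : ℝ) * z (Fin.castAdd K i') + (c.2 : ℝ)) u := by
  rcases u with v | d
  · simp
  · simp

/-- A base coordinate is not a fibre coordinate. -/
theorem castAdd_ne_natAdd (i : Fin b) (v : Fin K) :
    (Fin.castAdd K i : Fin (b + K)) ≠ Fin.natAdd b v :=
  fun h => by have := congrArg Fin.val h; simp at this; omega

/-- Distinct Janus players are distinct functions. -/
theorem player_ne {u v : Fin K ⊕ ((Fin b → ℚ) × ℚ)} (huv : u ≠ v) : ∃ z : Fin (b + K) → ℝ,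
    Sum.elim (fun j => z (Fin.natAdd b j))
      (fun c => ∑ i', (c.1 i' : ℝ) * z (Fin.castAdd K i') + (c.2 : ℝ)) u ≠
    Sum.elim (fun j => z (Fin.natAdd b j))
      (fun c => ∑ i', (c.1 i' : ℝ) * z (Fin.castAdd K i') + (c.2 : ℝ)) v := by
  have key : ∀ (w : Fin K) (d : (Fin b → ℚ) × ℚ), ∃ z : Fin (b + K) → ℝ,
      z (Fin.natAdd b w) ≠ ∑ i', (d.1 i' : ℝ) * z (Fin.castAdd K i') + (d.2 : ℝ) := fun w d => by
    refine ⟨fun j => if j = Fin.natAdd b w then (d.2 : ℝ) + 1 else 0, ?_⟩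
    simp [castAdd_ne_natAdd]
  rcases u with w | d <;> rcases v with w' | d'
  · refine ⟨fun j => if j = Fin.natAdd b w then 1 else 0, ?_⟩
    have hne : w' ≠ w := fun h => huv (by rw [h])
    simp [hne]
  · simpa using key w d'
  · obtain ⟨z, hz⟩ := key w' d; exact ⟨z, by simpa using hz.symm⟩
  · by_cases h2 : d.2 = d'.2
    · have h1 : d.1 ≠ d'.1 := fun h1 => huv (by rw [Prod.ext h1 h2])
      obtain ⟨i, hi⟩ := Function.ne_iff.mp h1
      refine ⟨fun j => if j = Fin.castAdd K i then 1 else 0, ?_⟩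
      have hs : ∀ d₀ : (Fin b → ℚ) × ℚ, (∑ x, (d₀.1 x : ℝ) *
          if (Fin.castAdd K x : Fin (b + K)) = Fin.castAdd K i then 1 else 0) = d₀.1 i :=
          fun d₀ => by
        simp_rw [(Fin.castAdd_injective _ _).eq_iff]
        simp
      simp only [Sum.elim_inr, hs, h2, ne_eq, add_left_inj, Rat.cast_inj]
      exact hi
    · refine ⟨fun _ => 0, ?_⟩
      simpa using h2


/-- Difference rows: `0 < (d' − d)(x) ↔ d(x) < d'(x)`. -/
theorem sub_row_pos_iff (d d' : (Fin b → ℚ) × ℚ) (z : Fin (b + K) → ℝ) :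
    0 < ∑ i, ((d'.1 i - d.1 i : ℚ) : ℝ) * z (Fin.castAdd K i) + ((d'.2 - d.2 : ℚ) : ℝ) ↔
      ∑ i, (d.1 i : ℝ) * z (Fin.castAdd K i) + (d.2 : ℝ) <
        ∑ i, (d'.1 i : ℝ) * z (Fin.castAdd K i) + (d'.2 : ℝ) := by
  have hs : ∑ i, ((d'.1 i - d.1 i : ℚ) : ℝ) * z (Fin.castAdd K i) =
      ∑ i, (d'.1 i : ℝ) * z (Fin.castAdd K i) - ∑ i, (d.1 i : ℝ) * z (Fin.castAdd K i) := by
    rw [← Finset.sum_sub_distrib]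
    exact Finset.sum_congr rfl fun i _ => by push_cast; ring
  rw [hs]
  push_cast
  constructor <;> intro h <;> linarith

/-! ### Unfolding the polynomial factor of a `G₂` integrand on a branch piece -/

section Unfold

variable {b k m m' n₁ n₂ : ℕ} (s : KZ.IntegralRep (b + 1 + k)) (ℓ₁ : (Fin b → ℚ) × ℚ)
  (A B : Bool → MvPolynomial (Fin (b + 1 + k)) ℚ)
  (hAB : ∀ β z, (aeval z (A β) = if β then ∑ i, (ℓ₁.1 i : ℝ) * z (Fin.castAdd k (Fin.castSucc i)) +
      (ℓ₁.2 : ℝ) else z (Fin.castAdd k (Fin.last b))) ∧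
    (aeval z (B β) = if β then z (Fin.castAdd k (Fin.last b)) else
      ∑ i, (ℓ₁.1 i : ℝ) * z (Fin.castAdd k (Fin.castSucc i)) + (ℓ₁.2 : ℝ)))

variable (L : Fin m → (Fin b → ℚ) × ℚ) (e : Fin m → ℕ) (p : MvPolynomial (Fin b) ℚ)
  (ℓ₂ : (Fin b → ℚ) × ℚ) (a : Fin k → Option ((Fin (b + 1) → ℚ) × ℚ))

include hAB in
/-- **Unfolding the polynomial factor on a branch piece**: on `{A_β < B_β}` the integrand is
`(B_β − A_β)^{n₁} · (±1)^{n₁} g₀` with `g₀` free of the factor `(y − ℓ₁)^{n₁}`; reverse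
Newton–Leibniz `n₁` times (`integrateOutLow_unfold`). -/
theorem exists_unfolded
    (hint : EqOn s.integrand (fun z => MvPolynomial.aeval (fun i => z (Fin.castAdd k
      (Fin.castSucc i))) p / (∏ j, (∑ i, ((L j).1 i : ℝ) * z (Fin.castAdd k (Fin.castSucc i)) +
      ((L j).2 : ℝ)) ^ e j) * ((z (Fin.castAdd k (Fin.last b)) - (∑ i, (ℓ₁.1 i : ℝ) *
      z (Fin.castAdd k (Fin.castSucc i)) + (ℓ₁.2 : ℝ))) ^ n₁ / (z (Fin.castAdd k (Fin.last b)) -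
      (∑ i, (ℓ₂.1 i : ℝ) * z (Fin.castAdd k (Fin.castSucc i)) + (ℓ₂.2 : ℝ))) ^ n₂) *
      ∏ i, (a i).elim 1 (fun c => 1 / (z (Fin.natAdd (b + 1) i) -
      (∑ i', (c.1 i' : ℝ) * z (Fin.castAdd k i') + (c.2 : ℝ))))) s.domain) (β : Bool) :
    ∃ U : KZ.IntegralRep (b + 1 + k + n₁),
      U.domain = {z | (fun i => z (Fin.castAdd n₁ i)) ∈
          s.domain ∩ {z | aeval z (A β) < aeval z (B β)} ∧
        ∀ i : Fin n₁, aeval (fun i => z (Fin.castAdd n₁ i)) (A β) < z (Fin.natAdd (b + 1 + k) i) ∧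
          z (Fin.natAdd (b + 1 + k) i) < aeval (fun i => z (Fin.castAdd n₁ i)) (B β)} ∧
      U.integrand = (fun z => (if β then (1 : ℝ) else -1) ^ n₁ *
        (MvPolynomial.aeval (fun i => z (Fin.castAdd n₁ (Fin.castAdd k (Fin.castSucc i)))) p /
        (∏ j, (∑ i, ((L j).1 i : ℝ) * z (Fin.castAdd n₁ (Fin.castAdd k (Fin.castSucc i))) +
          ((L j).2 : ℝ)) ^ e j) /
        (z (Fin.castAdd n₁ (Fin.castAdd k (Fin.last b))) - (∑ i, (ℓ₂.1 i : ℝ) *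
          z (Fin.castAdd n₁ (Fin.castAdd k (Fin.castSucc i))) + (ℓ₂.2 : ℝ))) ^ n₂ *
        ∏ i, (a i).elim 1 (fun c => 1 / (z (Fin.castAdd n₁ (Fin.natAdd (b + 1) i)) -
          (∑ i', (c.1 i' : ℝ) * z (Fin.castAdd n₁ (Fin.castAdd k i')) + (c.2 : ℝ)))))) ∧
      KZ.of (s.restrict (s.domain ∩ {z | aeval z (A β) < aeval z (B β)})
        (s.isSemialgebraic_domain.inter (isSemialgebraic_setOf_eval_lt _ _)) inter_subset_left) -
        KZ.of U ∈ KZ.relations := by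
  set g : (Fin (b + 1 + k) → ℝ) → ℝ := fun z => (if β then (1 : ℝ) else -1) ^ n₁ *
    (MvPolynomial.aeval (fun i => z (Fin.castAdd k (Fin.castSucc i))) p /
    (∏ j, (∑ i, ((L j).1 i : ℝ) * z (Fin.castAdd k (Fin.castSucc i)) + ((L j).2 : ℝ)) ^ e j) /
    (z (Fin.castAdd k (Fin.last b)) - (∑ i, (ℓ₂.1 i : ℝ) * z (Fin.castAdd k (Fin.castSucc i)) +
      (ℓ₂.2 : ℝ))) ^ n₂ *
    ∏ i, (a i).elim 1 (fun c => 1 / (z (Fin.natAdd (b + 1) i) -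
      (∑ i', (c.1 i' : ℝ) * z (Fin.castAdd k i') + (c.2 : ℝ))))) with hg_def
  set D := s.domain ∩ {z | aeval z (A β) < aeval z (B β)} with hD_def
  have hD : IsSemialgebraic ℚ D :=
    s.isSemialgebraic_domain.inter (isSemialgebraic_setOf_eval_lt _ _)
  have hABD : ∀ z ∈ D, aeval z (A β) < aeval z (B β) := fun z hz => hz.2
  have hkey : ∀ z ∈ D, s.integrand z = (aeval z (B β) - aeval z (A β)) ^ n₁ * g z := by
    intro z hz
    obtain ⟨hA, hB⟩ := hAB β z
    have hy : z (Fin.castAdd k (Fin.last b)) - (∑ i, (ℓ₁.1 i : ℝ) *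
        z (Fin.castAdd k (Fin.castSucc i)) + (ℓ₁.2 : ℝ)) =
        (if β then (1 : ℝ) else -1) * (aeval z (B β) - aeval z (A β)) := by
      cases β <;> simp only [Bool.false_eq_true, if_false, if_true] at hA hB ⊢ <;>
        rw [hA, hB] <;> ring
    rw [hint hz.1]
    dsimp only
    rw [hy, mul_pow, hg_def]
    ring
  have hg : IsSemialgebraicFunOn ℚ D g := by
    have h1 : IsSemialgebraicFunOn ℚ D s.integrand :=
      s.isSemialgebraicFunOn_integrand.mono inter_subset_left hD
    have h2 := isSemialgebraicFunOn_aeval_div_aeval hD 1 ((B β - A β) ^ n₁)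
      (fun z hz => by simpa using pow_ne_zero _ (sub_ne_zero.2 (hABD z hz).ne'))
    refine (IsSemialgebraicFunOn.mul_holds h1 h2).congr fun z hz => ?_
    have hne : (aeval z (B β) - aeval z (A β)) ^ n₁ ≠ 0 :=
      pow_ne_zero _ (sub_ne_zero.2 (hABD z hz).ne')
    rw [Pi.mul_apply, hkey z hz, map_one, map_pow, map_sub]
    field_simp
  have hi : IntegrableOn (fun z => (aeval z (B β) - aeval z (A β)) ^ n₁ * g z) D :=
    (s.integrableOn.mono_set inter_subset_left).congr_fun (fun z hz => hkey z hz)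
      (IsSemialgebraic.measurableSet_holds hD)
  obtain ⟨U, hUd, hUi, hUr⟩ := integrateOutLow_unfold _ D hD _ _ hABD n₁ g hg hi
  exact ⟨U, hUd, hUi, hUr _ rfl fun z hz => hkey z hz⟩


end Unfold

end IntegrateOutLow

open IntegrateOutLow in
/-- **Order-constrained Janus representations are sums of Janus band representations**
(registered sub-goal of `stub_integrateOutLow`). A bounded representation of dimension `b + K`
whose domain is cut out by finitely many strict order constraints between "players" — fibre
coordinates `z (natAdd b v)` and rational affine functions of the base — every fibre being
bounded below and above by some constraint, and whose integrand has the Janus form, is congruent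
modulo the KZ moves to a `ℤ`-combination of elements of `J b`: dissect by the total orders of the
players (rule 1a; ties are null, `of_sub_sum_cell_mem_relations`); on the piece of a chain
consistent with the constraints every fibre has a unique lower and upper neighbour and the other
comparisons are rows of the base cell; inconsistent chains give empty pieces. -/
theorem integrateOutLow_orderCells (b K m : ℕ) (s : KZ.IntegralRep (b + K)) (C : Finset ((Fin K ⊕ ((Fin b → ℚ) × ℚ)) × (Fin K ⊕ ((Fin b → ℚ) × ℚ)))) (L : Fin m → (Fin b → ℚ) × ℚ) (e : Fin m → ℕ) (p : MvPolynomial (Fin b) ℚ) (a : Fin K → Option ((Fin b → ℚ) × ℚ)) (hbd : Bornology.IsBounded s.domain) (hlu : ∀ v, (∃ q ∈ C, q.2 = Sum.inl v) ∧ (∃ q ∈ C, q.1 = Sum.inl v)) (hdom : s.domain = {z | ∀ q ∈ C, Sum.elim (fun j => z (Fin.natAdd b j)) (fun c => ∑ i', (c.1 i' : ℝ) * z (Fin.castAdd K i') + (c.2 : ℝ)) q.1 < Sum.elim (fun j => z (Fin.natAdd b j)) (fun c => ∑ i', (c.1 i' : ℝ) * z (Fin.castAdd K i') + (c.2 : ℝ))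 q.2}) (hint : EqOn s.integrand (fun z => MvPolynomial.aeval (fun i => z (Fin.castAdd K i)) p / (∏ j, (∑ i, ((L j).1 i : ℝ) * z (Fin.castAdd K i) + ((L j).2 : ℝ)) ^ e j) * ∏ i, (a i).elim 1 (fun c => 1 / (z (Fin.natAdd b i) - (∑ i', (c.1 i' : ℝ) * z (Fin.castAdd K i') + (c.2 : ℝ))))) s.domain) : ∃ c ∈ AddSubgroup.closure {w : KZ.FormalRep | ∃ (k m m' : ℕ) (s : KZ.IntegralRep (b + k)) (M : Fin m' → (Fin b → ℚ) × ℚ) (L : Fin m → (Fin b → ℚ) × ℚ) (e : Fin m → ℕ) (p : MvPolynomial (Fin b) ℚ) (a : Fin k → Option ((Fin b → ℚ) × ℚ)) (lo hi : Fin k → Fin k ⊕ ((Fin b → ℚ) × ℚ)), Bornology.IsBounded s.domain ∧ s.domain = {z | (∀ j, 0 < ∑ i, ((M j).1 i : ℝ) * z (Fin.castAdd k i) + ((M j).2 : ℝ)) ∧ ∀ i, Sum.elim (fun j => z (Fin.natAdd b j)) (fun c => ∑ i', (c.1 i' : ℝ) * z (Fin.castAdd k i') + (c.2 : ℝ)) (lo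 i) < z (Fin.natAdd b i) ∧ z (Fin.natAdd b i) < Sum.elim (fun j => z (Fin.natAdd b j)) (fun c => ∑ i', (c.1 i' : ℝ) * z (Fin.castAdd k i') + (c.2 : ℝ)) (hi i)} ∧ EqOn s.integrand (fun z => MvPolynomial.aeval (fun i => z (Fin.castAdd k i)) p / (∏ j, (∑ i, ((L j).1 i : ℝ) * z (Fin.castAdd k i) + ((L j).2 : ℝ)) ^ e j) * ∏ i, (a i).elim 1 (fun c => 1 / (z (Fin.natAdd b i) - (∑ i', (c.1 i' : ℝ) * z (Fin.castAdd k i') + (c.2 : ℝ))))) s.domain ∧ w = KZ.of s}, KZ.of s - c ∈ KZ.relations := by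
  classical
  set PV : Fin K ⊕ ((Fin b → ℚ) × ℚ) → (Fin (b + K) → ℝ) → ℝ := fun u z =>
    Sum.elim (fun j => z (Fin.natAdd b j))
      (fun c => ∑ i', (c.1 i' : ℝ) * z (Fin.castAdd K i') + (c.2 : ℝ)) u with hPV
  have hdom' : s.domain = {z | ∀ q ∈ C, PV q.1 z < PV q.2 z} := hdom
  set A : Finset ((Fin b → ℚ) × ℚ) :=
    C.biUnion fun q => q.1.getRight?.toFinset ∪ q.2.getRight?.toFinset with hA_def
  have hA : ∀ q ∈ C, ∀ d, (q.1 = Sum.inr d ∨ q.2 = Sum.inr d) → d ∈ A := by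
    intro q hq d h
    rw [hA_def, Finset.mem_biUnion]
    refine ⟨q, hq, ?_⟩
    rcases h with h | h <;> simp [h]
  set P : Fin K ⊕ A → MvPolynomial (Fin (b + K)) ℚ := fun x =>
    Sum.elim (fun v => (X (Fin.natAdd b v) : MvPolynomial (Fin (b + K)) ℚ))
      (fun d => rename (Fin.castAdd K) (∑ i, MvPolynomial.C (d.1 i) * X i + MvPolynomial.C d.2))
      (Sum.map id Subtype.val x) with hP_def
  have hval : ∀ x z, aeval z (P x) = PV (Sum.map id Subtype.val x) z := fun x z =>
    aeval_player _ z
  have hP : ∀ x y, x ≠ y → ∃ z, aeval z (P x) ≠ aeval z (P y) := fun x y hxy => by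
    obtain ⟨z, hz⟩ := player_ne (b := b) (K := K) (fun h => hxy
      (Sum.map_injective.2 ⟨fun _ _ h => h, Subtype.val_injective⟩ h))
    exact ⟨z, by rwa [hval, hval]⟩
  have hsplit := of_sub_sum_cell_mem_relations P hP s
  have hcell : ∀ σ : Fin (Fintype.card (Fin K ⊕ A)) ≃ Fin K ⊕ A,
      {z : Fin (b + K) → ℝ | StrictMono fun i => aeval z (P (σ i))} =
      {z | StrictMono fun i => PV (Sum.map id Subtype.val (σ i)) z} := fun σ => by
    simp_rw [hval]
  set piece := fun σ : Fin (Fintype.card (Fin K ⊕ A)) ≃ Fin K ⊕ A =>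
    s.restrict (s.domain ∩ {z | StrictMono fun i => aeval z (P (σ i))})
      (s.isSemialgebraic_domain.inter (isSemialgebraic_cell P σ)) inter_subset_left with hpiece
  have hgood : ∀ σ : Fin (Fintype.card (Fin K ⊕ A)) ≃ Fin K ⊕ A,
      (∀ q ∈ C, ∃ x₁ x₂ : Fin K ⊕ A, Sum.map id Subtype.val x₁ = q.1 ∧
        Sum.map id Subtype.val x₂ = q.2 ∧ σ.symm x₁ < σ.symm x₂) →
      KZ.of (piece σ) ∈ {w : KZ.FormalRep | ∃ (k m m' : ℕ) (s : KZ.IntegralRep (b + k))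
        (M : Fin m' → (Fin b → ℚ) × ℚ) (L : Fin m → (Fin b → ℚ) × ℚ) (e : Fin m → ℕ)
        (p : MvPolynomial (Fin b) ℚ) (a : Fin k → Option ((Fin b → ℚ) × ℚ))
        (lo hi : Fin k → Fin k ⊕ ((Fin b → ℚ) × ℚ)), Bornology.IsBounded s.domain ∧
        s.domain = {z | (∀ j, 0 < ∑ i, ((M j).1 i : ℝ) * z (Fin.castAdd k i) + ((M j).2 : ℝ)) ∧
        ∀ i, Sum.elim (fun j => z (Fin.natAdd b j))
        (fun c => ∑ i', (c.1 i' : ℝ) * z (Fin.castAdd k i') + (c.2 : ℝ)) (lo i) <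
        z (Fin.natAdd b i) ∧ z (Fin.natAdd b i) < Sum.elim (fun j => z (Fin.natAdd b j))
        (fun c => ∑ i', (c.1 i' : ℝ) * z (Fin.castAdd k i') + (c.2 : ℝ)) (hi i)} ∧
        EqOn s.integrand (fun z => MvPolynomial.aeval (fun i => z (Fin.castAdd k i)) p /
        (∏ j, (∑ i, ((L j).1 i : ℝ) * z (Fin.castAdd k i) + ((L j).2 : ℝ)) ^ e j) *
        ∏ i, (a i).elim 1 (fun c => 1 / (z (Fin.natAdd b i) -
        (∑ i', (c.1 i' : ℝ) * z (Fin.castAdd k i') + (c.2 : ℝ))))) s.domain ∧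
        w = KZ.of s} := by
    intro σ hσ
    obtain ⟨lo', hi', hEq⟩ := exists_inter_chain_eq PV A C σ hσ hlu
    refine ⟨K, m, Fintype.card (Fin K ⊕ A), piece σ, fun i =>
      if h : i.val + 1 < Fintype.card (Fin K ⊕ A) then
        Sum.elim (fun _ => ((0 : Fin b → ℚ), (1 : ℚ))) (fun d => Sum.elim (fun _ => (0, 1))
          (fun d' => (d'.1 - d.1, d'.2 - d.2)) (Sum.map id Subtype.val (σ ⟨i.val + 1, h⟩)))
          (Sum.map id Subtype.val (σ i)) else (0, 1),
      L, e, p, a, lo', hi', hbd.subset inter_subset_left, ?_, hint.mono inter_subset_left, rfl⟩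
    show s.domain ∩ {z | StrictMono fun i => aeval z (P (σ i))} = _
    rw [hdom', hcell σ, hEq]
    ext z
    simp only [mem_setOf_eq]
    refine and_congr ⟨fun h j => ?_, fun h i hi d d' h1 h2 => ?_⟩ Iff.rfl
    · by_cases hj : j.val + 1 < Fintype.card (Fin K ⊕ A)
      · rw [dif_pos hj]
        rcases h1 : Sum.map id Subtype.val (σ j) with v | d
        · simp
        · rcases h2 : Sum.map id Subtype.val (σ ⟨j.val + 1, hj⟩) with v' | d'
          · simp
          · have hlt := h j hj d d' h1 h2
            simp only [Sum.elim_inr, Pi.sub_apply, sub_row_pos_iff]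
            exact hlt
      · rw [dif_neg hj]
        simp
    · have hr := h i
      rw [dif_pos hi, h1, h2] at hr
      simp only [Sum.elim_inr, Pi.sub_apply, sub_row_pos_iff] at hr
      exact hr
  have hbad : ∀ σ : Fin (Fintype.card (Fin K ⊕ A)) ≃ Fin K ⊕ A,
      ¬ (∀ q ∈ C, ∃ x₁ x₂ : Fin K ⊕ A, Sum.map id Subtype.val x₁ = q.1 ∧
        Sum.map id Subtype.val x₂ = q.2 ∧ σ.symm x₁ < σ.symm x₂) →
      KZ.of (piece σ) ∈ KZ.relations := by
    intro σ hσ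
    refine KZ.of_mem_relations_of_volume_eq_zero _ ?_
    show volume (s.domain ∩ {z | StrictMono fun i => aeval z (P (σ i))}) = 0
    rw [hdom', hcell σ, inter_chain_eq_empty PV A C hA σ hσ, measure_empty]
  refine ⟨∑ σ ∈ Finset.univ.filter (fun σ : Fin (Fintype.card (Fin K ⊕ A)) ≃ Fin K ⊕ A =>
      ∀ q ∈ C, ∃ x₁ x₂ : Fin K ⊕ A, Sum.map id Subtype.val x₁ = q.1 ∧
        Sum.map id Subtype.val x₂ = q.2 ∧ σ.symm x₁ < σ.symm x₂), KZ.of (piece σ),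
    AddSubgroup.sum_mem _ fun σ hσ =>
      AddSubgroup.subset_closure (hgood σ (Finset.mem_filter.1 hσ).2), ?_⟩
  rw [← Finset.sum_filter_add_sum_filter_not Finset.univ
    (fun σ : Fin (Fintype.card (Fin K ⊕ A)) ≃ Fin K ⊕ A =>
      ∀ q ∈ C, ∃ x₁ x₂ : Fin K ⊕ A, Sum.map id Subtype.val x₁ = q.1 ∧
        Sum.map id Subtype.val x₂ = q.2 ∧ σ.symm x₁ < σ.symm x₂)] at hsplit
  have hb : ∑ σ ∈ Finset.univ.filter (fun σ : Fin (Fintype.card (Fin K ⊕ A)) ≃ Fin K ⊕ A =>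
      ¬ ∀ q ∈ C, ∃ x₁ x₂ : Fin K ⊕ A, Sum.map id Subtype.val x₁ = q.1 ∧
        Sum.map id Subtype.val x₂ = q.2 ∧ σ.symm x₁ < σ.symm x₂), KZ.of (piece σ) ∈
      KZ.relations :=
    sum_mem fun σ hσ => hbad σ (Finset.mem_filter.1 hσ).2
  convert KZ.relations.add_mem hsplit hb using 1
  abel

end Summit.KontsevichZagierPeriods.ArrangementNormalForm.JanusBands
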